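import Mathlib
import Literature.Combinatorics.Enumerative.RestrictedInvolutionsMotzkin
import HarnessLib

/-!
# The Motzkin path of an involution: bijections `I_n(3412) ≃ 𝓜_n ≃ I_n(4321)` (Barnabei–Bonetti–Silimbani 2011, §3, Theorems 2 and 7)

Layer `Literature/Combinatorics/Enumerative`, namespace `Literature.Combinatorics.Enumerative.PermContainsPattern`; lane
`lit-hodgefound` (prover seat p13, generation 39, theme «nonnesting / noncrossing matchings and restricted
involutions»).  Sequel of `RestrictedInvolutionsMotzkin.lean` (`|I_n(3412)| = |I_n(4321)| = #motzkinWords n = M_n`)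
and `MotzkinWords.lean` (`motzkinWords n`).

## Source

M. Barnabei, F. Bonetti, M. Silimbani, *Restricted involutions and Motzkin paths*, Adv. Appl. Math. **47** (2011)
102–115 = arXiv:0812.0463 [BarnabeiBonettiSilimbani2011] (held text `paper-arxiv-0812.0463`, §3–§5):

> We now define a bijection `Φ` between the set `I_n` of involutions of the symmetric group `S_n` and the set of
> labelled Motzkin paths of length `n` … we construct the labelled Motzkin path `Φ(τ)` by adding a step for every
> integer `1 ≤ i ≤ n` as follows: if `τ(i) = i` we add a horizontal step at `i`-th position; if `τ(i) > i` we add an up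
> step at `i`-th position; if `τ(i) < i` we add a down step at `i`-th position [labelled by the rank of `τ(i)` among
> the open excedances].
> **Theorem 2.** … `τ` avoids the pattern `4321` if and only if `λ` is the unitary labelling.
> **Theorem 7.** … `τ` avoids the pattern `3412` if and only if `λ` is the maximal labelling.
> [hence] «The preceding result yields a bijection between the sets `𝓜_n` and `I_n(3412)`» (and `I_n(4321)`, §3).

## Formalisation (arc language)

* §1 `motzkinPath u : Fin n → Fin 3` — the UNLABELLED path `M` of `Φ(u)`: letter `1` (up) at the openers `i < u i`,
  `2` (down) at the closers `u i < i`, `0` (level) at the fixed points (one definition; `motzkinPath_apply_eq_*_iff`).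
* §2 `motzkinPath_mem_motzkinWords`: for an involution it is a Motzkin word (the closers are matched to earlier
  openers).
* §3 The labelling is forced: two NONCROSSING (resp. NONNESTING) involutions with the same path coincide
  (★★ `eq_of_motzkinPath_eq_of_noncrossing`, ★★ `eq_of_motzkinPath_eq_of_nonnesting` — each closer closes the latest,
  resp. the earliest, open excedance; induction on the closers).
* §4 With the counts `|I_n(3412)| = |I_n(4321)| = #motzkinWords n` (`RestrictedInvolutionsMotzkin.lean`), injectivity
  gives ★★★ `motzkinPath_bijective_av3412` and ★★★ `motzkinPath_bijective_av4321`: `u ↦ motzkinPath u` is a bijection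
  from `I_n(3412)`, resp. `I_n(4321)`, onto the Motzkin words of length `n` (THEOREMS 7 and 2 as bijections
  `𝓜_n ↔ I_n(3412)`, `𝓜_n ↔ I_n(4321)`); `existsUnique_av3412_motzkinPath_eq`, `existsUnique_av4321_motzkinPath_eq`,
  and the step-preserving bijection `I_n(3412) → I_n(4321)` (`existsUnique_av4321_same_motzkinPath`).
-/

namespace Literature.Combinatorics.Enumerative

namespace PermContainsPattern

open Finset Equiv

variable {n : ℕ}

/-! ### §1 The Motzkin path of a permutation -/

/-- **The Motzkin path `Φ(u)` (unlabelled) of `u`**: the word with an up step (`1`) at each excedance `i < u i`, a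
down step (`2`) at each deficiency `u i < i`, and a level step (`0`) at each fixed point.
[cite: BarnabeiBonettiSilimbani2011, §3 (definition of `Φ`; arXiv 0812.0463)] -/
def motzkinPath (u : Perm (Fin n)) : Fin n → Fin 3 :=
  fun i => if i < u i then 1 else if u i < i then 2 else 0

/-- Up steps are the excedances. [cite: BarnabeiBonettiSilimbani2011, §3 (arXiv 0812.0463)] -/
theorem motzkinPath_apply_eq_one_iff (u : Perm (Fin n)) (i : Fin n) : motzkinPath u i = 1 ↔ i < u i := by
  unfold motzkinPath
  split_ifs with h1 h2
  · exact iff_of_true rfl h1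
  · exact iff_of_false (by decide) h1
  · exact iff_of_false (by decide) h1

/-- Down steps are the deficiencies. [cite: BarnabeiBonettiSilimbani2011, §3 (arXiv 0812.0463)] -/
theorem motzkinPath_apply_eq_two_iff (u : Perm (Fin n)) (i : Fin n) : motzkinPath u i = 2 ↔ u i < i := by
  unfold motzkinPath
  split_ifs with h1 h2
  · exact iff_of_false (by decide) (lt_asymm h1)
  · exact iff_of_true rfl h2
  · exact iff_of_false (by decide) h2

/-- Level steps are the fixed points. [cite: BarnabeiBonettiSilimbani2011, §3 (arXiv 0812.0463)] -/
theorem motzkinPath_apply_eq_zero_iff (u : Perm (Fin n)) (i : Fin n) : motzkinPath u i = 0 ↔ u i = i := by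
  unfold motzkinPath
  split_ifs with h1 h2
  · exact iff_of_false (by decide) (ne_of_gt h1)
  · exact iff_of_false (by decide) (ne_of_lt h2)
  · exact iff_of_true rfl (le_antisymm (not_lt.1 h1) (not_lt.1 h2))

/-- Two permutations have the same Motzkin path iff they have the same excedances and the same deficiencies.
[cite: BarnabeiBonettiSilimbani2011, §3 (arXiv 0812.0463)] -/
theorem motzkinPath_eq_iff (u v : Perm (Fin n)) :
    motzkinPath u = motzkinPath v ↔ ∀ i, (i < u i ↔ i < v i) ∧ (u i < i ↔ v i < i) := by
  constructor
  · intro h i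
    have h1 := congrFun h i
    refine ⟨?_, ?_⟩
    · rw [← motzkinPath_apply_eq_one_iff, ← motzkinPath_apply_eq_one_iff, h1]
    · rw [← motzkinPath_apply_eq_two_iff, ← motzkinPath_apply_eq_two_iff, h1]
  · intro h
    funext i
    obtain ⟨h1, h2⟩ := h i
    unfold motzkinPath
    rw [if_congr h1 rfl (if_congr h2 rfl rfl)]

/-! ### §2 The path of an involution is a Motzkin word -/

/-- ★ For an involution, `motzkinPath u` is a Motzkin word: `u` matches the down steps with earlier up steps, so the
up steps are as many as the down steps, and at least as many in every prefix.
[cite: BarnabeiBonettiSilimbani2011, §3 («we construct the labelled Motzkin path `Φ(τ)`»; arXiv 0812.0463)] -/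
theorem motzkinPath_mem_motzkinWords {u : Perm (Fin n)} (hu : ∀ x, u (u x) = x) : motzkinPath u ∈ motzkinWords n := by
  rw [mem_motzkinWords]
  have hf1 : ∀ s : Finset (Fin n), (s.filter fun i => motzkinPath u i = 1) = s.filter fun i => i < u i :=
    fun s => filter_congr fun i _ => motzkinPath_apply_eq_one_iff u i
  have hf2 : ∀ s : Finset (Fin n), (s.filter fun i => motzkinPath u i = 2) = s.filter fun i => u i < i :=
    fun s => filter_congr fun i _ => motzkinPath_apply_eq_two_iff u i
  constructor
  · rw [hf1, hf2]
    refine card_nbij' u u (fun i hi => ?_) (fun i hi => ?_) (fun i _ => hu i) (fun i _ => hu i)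
    · rw [mem_coe, mem_filter] at hi ⊢; exact ⟨mem_univ _, by rw [hu]; exact hi.2⟩
    · rw [mem_coe, mem_filter] at hi ⊢; exact ⟨mem_univ _, by rw [hu]; exact hi.2⟩
  · intro t _
    rw [show (univ.filter fun i : Fin n => (i : ℕ) < t ∧ motzkinPath u i = 2) =
        (univ.filter fun i : Fin n => (i : ℕ) < t).filter fun i => motzkinPath u i = 2 from by
          rw [filter_filter],
      show (univ.filter fun i : Fin n => (i : ℕ) < t ∧ motzkinPath u i = 1) =
        (univ.filter fun i : Fin n => (i : ℕ) < t).filter fun i => motzkinPath u i = 1 from by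
          rw [filter_filter], hf1, hf2, filter_filter, filter_filter]
    refine card_le_card_of_injOn u (fun i hi => ?_) (fun i _ i' _ h => u.injective h)
    rw [mem_coe, mem_filter] at hi ⊢
    exact ⟨mem_univ _, lt_trans (Fin.lt_def.1 hi.2.2) hi.2.1, by rw [hu]; exact hi.2.2⟩

/-! ### §3 The path determines a noncrossing involution, and a nonnesting involution -/

/-- The inductive step for THEOREM 7: if two involutions `u'`, `v'` have the same steps, agree on the closers before
`c`, and `u'` is noncrossing, then `u' c < v' c` is impossible for a closer `c` (the excedance `v' c`, open at `c`,
would be closed by `u'` after `c`, crossing `(u' c, c)`). [cite: BarnabeiBonettiSilimbani2011, Theorem 7 (proof; arXiv 0812.0463)] -/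
private theorem noncrossing_step {u' v' : Perm (Fin n)} (hu' : ∀ x, u' (u' x) = x) (hv' : ∀ x, v' (v' x) = x)
    (hnu' : ∀ i j : Fin n, i < j → j < u' i → u' i < u' j → False)
    (h' : ∀ i, (i < u' i ↔ i < v' i) ∧ (u' i < i ↔ v' i < i)) {c : Fin n}
    (ih' : ∀ c₁ : Fin n, c₁ < c → u' c₁ < c₁ → u' c₁ = v' c₁) (hcv : v' c < c) (hlt : u' c < v' c) : False := by
  -- `o' = v' c` is an opener of `v'`, hence of `u'`
  have ho'v : v' c < v' (v' c) := by rw [hv']; exact hcv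
  have ho' : v' c < u' (v' c) := (h' (v' c)).1.2 ho'v
  have hne : u' (v' c) ≠ c := fun e => by
    have h1 := congrArg u' e
    rw [hu'] at h1
    rw [h1] at hlt
    exact lt_irrefl _ hlt
  rcases lt_or_gt_of_ne hne with hlt' | hgt'
  · -- `u'` closes `o'` before `c`: by induction `v'` closes it there too, not at `c`
    have hcl : u' (u' (v' c)) < u' (v' c) := by rw [hu']; exact ho'
    have e := ih' (u' (v' c)) hlt' hcl
    rw [hu'] at e
    -- `e : v' c = v' (u' (v' c))`
    have h2 := congrArg v' e
    rw [hv', hv'] at h2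
    exact hne h2.symm
  · -- `u'` closes `o'` after `c`: the arcs `(u' c, c)` and `(o', u' o')` of `u'` cross
    exact hnu' (u' c) (v' c) hlt (by rw [hu']; exact hcv) (by rw [hu']; exact hgt')

/-- The inductive step for THEOREM 2: same, with `v'` nonnesting (the excedance `u' c`, open at `c` for `v'`, would be
closed by `v'` after `c`, nesting `(v' c, c)`). [cite: BarnabeiBonettiSilimbani2011, Theorem 2 (proof; arXiv 0812.0463)] -/
private theorem nonnesting_step {u' v' : Perm (Fin n)} (hu' : ∀ x, u' (u' x) = x) (hv' : ∀ x, v' (v' x) = x)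
    (hnv' : ∀ i j : Fin n, i < j → j < v' j → v' j < v' i → False)
    (h' : ∀ i, (i < u' i ↔ i < v' i) ∧ (u' i < i ↔ v' i < i)) {c : Fin n}
    (ih' : ∀ c₁ : Fin n, c₁ < c → u' c₁ < c₁ → u' c₁ = v' c₁) (hcu : u' c < c) (hcv : v' c < c)
    (hlt : u' c < v' c) : False := by
  -- `o = u' c` is an opener of `u'`, hence of `v'`
  have hou : u' c < u' (u' c) := by rw [hu']; exact hcu
  have ho : u' c < v' (u' c) := (h' (u' c)).1.1 hou
  have hne : v' (u' c) ≠ c := fun e => by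
    have h1 := congrArg v' e
    rw [hv'] at h1
    rw [h1] at hlt
    exact lt_irrefl _ hlt
  rcases lt_or_gt_of_ne hne with hlt' | hgt'
  · -- `v'` closes `o` before `c`: then so does `u'`, not at `c`
    have hcl : v' (v' (u' c)) < v' (u' c) := by rw [hv']; exact ho
    have hcl' : u' (v' (u' c)) < v' (u' c) := (h' _).2.2 hcl
    have e := ih' (v' (u' c)) hlt' hcl'
    rw [hv'] at e
    -- `e : u' (v' (u' c)) = u' c`
    have h2 := congrArg u' e
    rw [hu', hu'] at h2
    exact hne h2
  · -- `v'` closes `o` after `c`: the arc `(v' c, c)` of `v'` is nested in `(o, v' o)`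
    exact hnv' (u' c) (v' c) hlt (by rw [hv']; exact hcv) (by rw [hv']; exact hgt')

/-- Two involutions with the same steps that agree on the closers are equal. [folklore] -/
private theorem eq_of_closers_eq {u v : Perm (Fin n)} (hu : ∀ x, u (u x) = x) (hv : ∀ x, v (v x) = x)
    (h : ∀ i, (i < u i ↔ i < v i) ∧ (u i < i ↔ v i < i)) (key : ∀ c : Fin n, u c < c → u c = v c) : u = v := by
  refine Equiv.ext fun x => ?_
  rcases lt_trichotomy (u x) x with hx | hx | hx
  · exact key x hx
  · have h0 : ¬ x < v x := fun h' => absurd ((h x).1.2 h') (by rw [hx]; exact lt_irrefl _)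
    have h2 : ¬ v x < x := fun h' => absurd ((h x).2.2 h') (by rw [hx]; exact lt_irrefl _)
    rw [hx]
    exact le_antisymm (not_lt.1 h2) (not_lt.1 h0)
  · have hc : u (u x) < u x := by rw [hu]; exact hx
    have e := key (u x) hc
    rw [hu] at e
    -- `e : x = v (u x)`
    calc u x = v (v (u x)) := (hv _).symm
      _ = v x := by rw [← e]

/-- ★★ **THEOREM 7 as uniqueness (the maximal labelling is forced).** Two involutions with noncrossing arcs and the
same Motzkin path are equal: by induction along the closers, each closer must close the LATEST open excedance — an
earlier choice would leave a later-closing excedance crossing it. [cite: BarnabeiBonettiSilimbani2011, Theorem 7 (arXiv 0812.0463)] -/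
theorem eq_of_motzkinPath_eq_of_noncrossing {u v : Perm (Fin n)} (hu : ∀ x, u (u x) = x) (hv : ∀ x, v (v x) = x)
    (hnu : ∀ i j : Fin n, i < j → j < u i → u i < u j → False)
    (hnv : ∀ i j : Fin n, i < j → j < v i → v i < v j → False) (h : motzkinPath u = motzkinPath v) : u = v := by
  rw [motzkinPath_eq_iff] at h
  have h'' : ∀ i, (i < v i ↔ i < u i) ∧ (v i < i ↔ u i < i) := fun i => ⟨(h i).1.symm, (h i).2.symm⟩
  have key : ∀ m : ℕ, ∀ c : Fin n, (c : ℕ) = m → u c < c → u c = v c := by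
    intro m
    induction m using Nat.strong_induction_on with
    | _ m ih =>
      intro c hcm hc
      have hc' : v c < c := (h c).2.1 hc
      have ihc : ∀ c₁ : Fin n, c₁ < c → u c₁ < c₁ → u c₁ = v c₁ := fun c₁ h1 h2 =>
        ih _ (by rw [← hcm]; exact Fin.lt_def.1 h1) c₁ rfl h2
      rcases lt_trichotomy (u c) (v c) with hlt | heq | hgt
      · exact (noncrossing_step hu hv hnu h ihc hc' hlt).elim
      · exact heq
      · exact (noncrossing_step hv hu hnv h'' (fun c₁ h1 h2 => (ihc c₁ h1 ((h'' c₁).2.1 h2)).symm) hc hgt).elim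
  exact eq_of_closers_eq hu hv h fun c hc => key _ c rfl hc

/-- ★★ **THEOREM 2 as uniqueness (the unitary labelling is forced).** Two involutions with nonnesting arcs and the same
Motzkin path are equal: each closer must close the EARLIEST open excedance — a later choice would leave an
earlier-opened excedance closing after it, nesting it. [cite: BarnabeiBonettiSilimbani2011, Theorem 2 (arXiv 0812.0463)] -/
theorem eq_of_motzkinPath_eq_of_nonnesting {u v : Perm (Fin n)} (hu : ∀ x, u (u x) = x) (hv : ∀ x, v (v x) = x)
    (hnu : ∀ i j : Fin n, i < j → j < u j → u j < u i → False)
    (hnv : ∀ i j : Fin n, i < j → j < v j → v j < v i → False) (h : motzkinPath u = motzkinPath v) : u = v := by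
  rw [motzkinPath_eq_iff] at h
  have h'' : ∀ i, (i < v i ↔ i < u i) ∧ (v i < i ↔ u i < i) := fun i => ⟨(h i).1.symm, (h i).2.symm⟩
  have key : ∀ m : ℕ, ∀ c : Fin n, (c : ℕ) = m → u c < c → u c = v c := by
    intro m
    induction m using Nat.strong_induction_on with
    | _ m ih =>
      intro c hcm hc
      have hc' : v c < c := (h c).2.1 hc
      have ihc : ∀ c₁ : Fin n, c₁ < c → u c₁ < c₁ → u c₁ = v c₁ := fun c₁ h1 h2 =>
        ih _ (by rw [← hcm]; exact Fin.lt_def.1 h1) c₁ rfl h2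
      rcases lt_trichotomy (u c) (v c) with hlt | heq | hgt
      · exact (nonnesting_step hu hv hnv h ihc hc hc' hlt).elim
      · exact heq
      · exact (nonnesting_step hv hu hnu h'' (fun c₁ h1 h2 => (ihc c₁ h1 ((h'' c₁).2.1 h2)).symm) hc' hc hgt).elim
  exact eq_of_closers_eq hu hv h fun c hc => key _ c rfl hc

/-! ### §4 The bijections `I_n(3412) ≃ 𝓜_n ≃ I_n(4321)` -/

/-- ★★★ **THEOREM 7 as a bijection `𝓜_n ↔ I_n(3412)`**: `u ↦ motzkinPath u` is a bijection from the `3412`-avoiding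
involutions of `[n]` onto the Motzkin words of length `n` (injective by §3, and both sides number `M_n`).
[cite: BarnabeiBonettiSilimbani2011, Theorem 7 and the remark after it («a bijection between the sets `𝓜_n` and
`I_n(3412)`»; arXiv 0812.0463)] -/
theorem motzkinPath_bijective_av3412 (n : ℕ) :
    Function.Bijective fun u : {u : Perm (Fin n) // u * u = 1 ∧ ¬ PermContainsPattern u ![3, 4, 1, 2]} =>
      (⟨motzkinPath u.1, motzkinPath_mem_motzkinWords ((mul_self_eq_one_iff_apply_apply u.1).1 u.2.1)⟩ :
        motzkinWords n) := by
  refine Function.Injective.bijective_of_nat_card_le (fun u v huv => ?_) (le_of_eq ?_)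
  · have hu := (mul_self_eq_one_iff_apply_apply u.1).1 u.2.1
    have hv := (mul_self_eq_one_iff_apply_apply v.1).1 v.2.1
    exact Subtype.ext (eq_of_motzkinPath_eq_of_noncrossing hu hv ((not_contains_3412_iff_noncrossing hu).1 u.2.2)
      ((not_contains_3412_iff_noncrossing hv).1 v.2.2) (congrArg Subtype.val huv))
  · rw [Nat.card_eq_finsetCard, card_motzkinWords, card_involutions_av3412]

/-- ★★★ **THEOREM 2 as a bijection `𝓜_n ↔ I_n(4321)`**: `u ↦ motzkinPath u` is a bijection from the `4321`-avoiding
involutions of `[n]` onto the Motzkin words of length `n`.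
[cite: BarnabeiBonettiSilimbani2011, Theorem 2 and §3 («such a bijection in the cases `τ = 3412` and `τ = 4321`»;
arXiv 0812.0463)] -/
theorem motzkinPath_bijective_av4321 (n : ℕ) :
    Function.Bijective fun u : {u : Perm (Fin n) // u * u = 1 ∧ ¬ PermContainsPattern u ![4, 3, 2, 1]} =>
      (⟨motzkinPath u.1, motzkinPath_mem_motzkinWords ((mul_self_eq_one_iff_apply_apply u.1).1 u.2.1)⟩ :
        motzkinWords n) := by
  refine Function.Injective.bijective_of_nat_card_le (fun u v huv => ?_) (le_of_eq ?_)
  · have hu := (mul_self_eq_one_iff_apply_apply u.1).1 u.2.1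
    have hv := (mul_self_eq_one_iff_apply_apply v.1).1 v.2.1
    exact Subtype.ext (eq_of_motzkinPath_eq_of_nonnesting hu hv ((not_contains_4321_iff_nonnesting hu).1 u.2.2)
      ((not_contains_4321_iff_nonnesting hv).1 v.2.2) (congrArg Subtype.val huv))
  · rw [Nat.card_eq_finsetCard, card_motzkinWords, card_involutions_av4321]

/-- ★★ Every Motzkin word is the path of exactly one `3412`-avoiding involution (the maximally labelled `Φ^{-1}`).
[cite: BarnabeiBonettiSilimbani2011, Theorem 7 (arXiv 0812.0463)] -/
theorem existsUnique_av3412_motzkinPath_eq {w : Fin n → Fin 3} (hw : w ∈ motzkinWords n) :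
    ∃! u : Perm (Fin n), (u * u = 1 ∧ ¬ PermContainsPattern u ![3, 4, 1, 2]) ∧ motzkinPath u = w := by
  obtain ⟨⟨u, hu⟩, hwu⟩ := (motzkinPath_bijective_av3412 n).2 ⟨w, hw⟩
  have hwu' : motzkinPath u = w := congrArg Subtype.val hwu
  refine ⟨u, ⟨hu, hwu'⟩, fun v ⟨hv, hvw⟩ => ?_⟩
  have := (motzkinPath_bijective_av3412 n).1 (a₁ := ⟨v, hv⟩) (a₂ := ⟨u, hu⟩) (Subtype.ext (hvw.trans hwu'.symm))
  exact congrArg Subtype.val this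

/-- ★★ Every Motzkin word is the path of exactly one `4321`-avoiding involution (the unitarily labelled `Φ^{-1}`).
[cite: BarnabeiBonettiSilimbani2011, Theorem 2 (arXiv 0812.0463)] -/
theorem existsUnique_av4321_motzkinPath_eq {w : Fin n → Fin 3} (hw : w ∈ motzkinWords n) :
    ∃! u : Perm (Fin n), (u * u = 1 ∧ ¬ PermContainsPattern u ![4, 3, 2, 1]) ∧ motzkinPath u = w := by
  obtain ⟨⟨u, hu⟩, hwu⟩ := (motzkinPath_bijective_av4321 n).2 ⟨w, hw⟩
  have hwu' : motzkinPath u = w := congrArg Subtype.val hwu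
  refine ⟨u, ⟨hu, hwu'⟩, fun v ⟨hv, hvw⟩ => ?_⟩
  have := (motzkinPath_bijective_av4321 n).1 (a₁ := ⟨v, hv⟩) (a₂ := ⟨u, hu⟩) (Subtype.ext (hvw.trans hwu'.symm))
  exact congrArg Subtype.val this

/-- ★★ **The step-preserving bijection `I_n(3412) → I_n(4321)`** (relabel `Φ(τ)` unitarily): every `3412`-avoiding
involution has exactly one `4321`-avoiding involution with the same excedances, deficiencies and fixed points.
[cite: BarnabeiBonettiSilimbani2011, Theorems 2 and 7 (arXiv 0812.0463)] -/
theorem existsUnique_av4321_same_motzkinPath {u : Perm (Fin n)} (hu : u * u = 1) :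
    ∃! v : Perm (Fin n), (v * v = 1 ∧ ¬ PermContainsPattern v ![4, 3, 2, 1]) ∧ motzkinPath v = motzkinPath u :=
  existsUnique_av4321_motzkinPath_eq (motzkinPath_mem_motzkinWords ((mul_self_eq_one_iff_apply_apply u).1 hu))

/-- … and conversely `I_n(4321) → I_n(3412)` (relabel maximally); in fact any involution has exactly one
`3412`-avoiding involution with the same steps. [cite: BarnabeiBonettiSilimbani2011, Theorems 2 and 7 (arXiv 0812.0463)] -/
theorem existsUnique_av3412_same_motzkinPath {u : Perm (Fin n)} (hu : u * u = 1) :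
    ∃! v : Perm (Fin n), (v * v = 1 ∧ ¬ PermContainsPattern v ![3, 4, 1, 2]) ∧ motzkinPath v = motzkinPath u :=
  existsUnique_av3412_motzkinPath_eq (motzkinPath_mem_motzkinWords ((mul_self_eq_one_iff_apply_apply u).1 hu))

end PermContainsPattern

end Literature.Combinatorics.Enumerative
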